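import Mathlib
import Summits.CriticalPhenomena.CardyFormulaZ2.Theorems.CardySelfRefinementGradientComparabilityLevelCurves
import Summits.CriticalPhenomena.CardyFormulaZ2.Theorems.CardySelfRefinementGradientComparabilityStubLevelSetTransportCorner
import HarnessLib

/-!
# Crux `GradientComparability` (stmt-CriticalPhenomena-10269), line `monotone-product-coordinates`:
# stub `stub_levelSetTransport` — transport of the Russo gradient inside level sets

Route `CardySelfRefinement`, sub-problem `CriticalPhenomena/CardyFormulaZ2`; vocabulary
(`P`, `Dρ`, `Dc`, `PathOK`, …) from `CardySelfRefinementDefs` (definitionally the route's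
`let`-chain).

For fixed `k, m, F` and mesh `η ≠ 0` the joint crossing probability agrees on `[0,1]²` with a
polynomial `Φ` (`exists_contDiff_two_eq_P`), and `Dρ = Φ_ρ`, `Dc = Φ_c` there.

* BULK (`levelSetTransport_bulk`).  Hypothesis: THE BET (the slope `Dρ/Dc` is `Θ`-Lipschitz in `c`
  across the level band, `ρ ≤ 1 - δ`).  Two band points of `[0, 1-δ] × [0,1]` on the same level `v`
  lie on the level leaf `c = ℓ(ρ)` of `Φ` (`stub_levelCurve_IFT`, `levelCurves_unconditional`,
  `stub_boundaryValues`); along it `d/dρ log Φ_c = ∂_c(Φ_ρ/Φ_c)` (★), which THE BET (applied on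
  the wider band `[vlo/2, (1+vhi)/2]`, so that level-`v` points are interior) bounds by `Θ`;
  hence `Dc(ρ₁,c₁) ≤ e^Θ Dc(ρ₀,c₀)` (`bulk_leaf_transport`).
* CORNER (`levelSetTransport_corner`).  Hypotheses: the corner BET (`Dρ ≠ 0` and `Dc/Dρ`
  `Θ'`-Lipschitz in `ρ` on the corner band of depth `2δ_B`) and the corner patch (comparability of
  `|Dρ|` across band points of the slices `{ρ = 1} ∪ {c = 0}`).  With `δ := δ_B/2`, a band point of
  `[1-δ_B, 1] × [0,1]` is joined inside its level set to a slice point, `|Dρ|` changing by at most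
  `e^{Θ'}` (twin identity `d/dc log|Φ_ρ| = ∂_ρ(Φ_c/Φ_ρ)` along the leaf as a graph over `c`;
  `corner_endpoint`: the leaf rises in `ρ` and cannot reach `c = 1`, where `P = 1`); the patch
  compares the two slice points.  Constant `e^{Θ'} · max Λ_P 0 · e^{Θ'}`.
-/

noncomputable section

namespace Summit.CriticalPhenomena.CardyFormulaZ2.Theorems.CardySelfRefinement

open scoped Topology
open Filter Set MeasureTheory
open Literature.Probability.LatticeModels Literature.Probability.Percolation
open Literature.Probability.Percolation.QuadCrossing
open Summit.CriticalPhenomena.CardyFormulaZ2.Theses.CardySelfRefinement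

-- adapted from `exists_contDiff_eq_P` (…Theorems/CardySelfRefinementRussoDriftPolynomial.lean)
/-- **`P` is a polynomial on the square, `C²` form**: for `η ≠ 0` there is a `C²` (indeed
polynomial) function `Φ` on `ℝ²` with `P k m F η ρ c = Φ (ρ, c)` for all `(ρ, c) ∈ [0,1]²`. -/
theorem exists_contDiff_two_eq_P (k m : ℕ) (F : Fin m → Quad (Set.univ : Set ℂ)) {η : ℝ}
    (hη : η ≠ 0) :
    ∃ Φ : ℝ × ℝ → ℝ, ContDiff ℝ 2 Φ ∧
      ∀ ρ ∈ Set.Icc (0 : ℝ) 1, ∀ c ∈ Set.Icc (0 : ℝ) 1, P k m F η ρ c = Φ (ρ, c) := by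
  classical
  obtain ⟨K, hK⟩ := exists_coinFinset k m F hη
  let b : (Site 2 × Fin 2 × Fin 3) → ℝ × ℝ → ℝ := fun i q =>
    if i.2.2 = 0 then (if ax k (i.1, i.2.1) then 1 / 2 else q.2)
    else if i.2.2 = 1 then 1 / 2 else q.1
  have hb : ∀ i, ContDiff ℝ 2 (b i) := by
    intro i
    simp only [b]
    split_ifs
    exacts [contDiff_const, contDiff_snd, contDiff_const, contDiff_fst]
  refine ⟨fun q => ∑ S ∈ K.powerset,
      if (↑S : Set (Site 2 × Fin 2 × Fin 3)) ∈ (cfg k) ⁻¹' Aloc m F η then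
        ∏ i ∈ K, (if i ∈ S then b i q else 1 - b i q) else 0, ?_, ?_⟩
  · refine ContDiff.sum fun S _ => ?_
    split_ifs
    · exact contDiff_prod fun i _ => by
        split_ifs
        exacts [hb i, contDiff_const.sub (hb i)]
    · exact contDiff_const
  · intro ρ hρ c hc
    rw [P_eq_sum_powerset k m F hη ρ c K hK]
    refine Finset.sum_congr rfl fun S _ => ?_
    split_ifs with hS
    · refine Finset.prod_congr rfl fun i _ => ?_
      have hi : (prm k ρ c i : ℝ) = b i (ρ, c) := by
        rw [coe_prm_eq k hρ hc i]
      rw [hi]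
    · rfl

/-- Threshold form of `P_η(ρ,1) = 1` (`P_one_eq_one_eventually`) for small mesh. -/
theorem P_one_eq_one_of_mem_Ioo {k : ℕ} (hk : k = 2 ∨ k = 3) (m : ℕ)
    (F : Fin m → Quad (Set.univ : Set ℂ)) :
    ∃ η₇ : ℝ, 0 < η₇ ∧ ∀ η ∈ Set.Ioo 0 η₇, ∀ ρ : ℝ, P k m F η ρ 1 = 1 := by
  have h := P_one_eq_one_eventually hk m F
  rw [Filter.Eventually, mem_nhdsGT_iff_exists_Ioo_subset] at h
  obtain ⟨η₇, hη₇, hsub⟩ := h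
  exact ⟨η₇, hη₇, fun η hη => hsub hη⟩

/-- **Bulk clause of `stub_levelSetTransport`.**  THE BET implies: same-level band points of
`[0, 1-δ] × [0,1]` have comparable `Dc`, mesh-uniformly (constant `exp Θ`, `Θ` = the BET constant of
the wider band `[vlo/2, (1+vhi)/2]`). -/
theorem levelSetTransport_bulk
    (hBET : ∀ k : ℕ, k = 2 ∨ k = 3 → ∀ γ : unitInterval → ℝ × ℝ, PathOK k γ →
      ∀ (m : ℕ) (F : Fin m → Quad (Set.univ : Set ℂ)), 0 < m → ∀ δ : ℝ, 0 < δ → δ ≤ 1 / 2 →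
        ∀ vlo vhi : ℝ, 0 < vlo → vlo < vhi → vhi < 1 →
          ∃ Θ η₁ : ℝ, 0 ≤ Θ ∧ 0 < η₁ ∧ ∀ η ∈ Set.Ioo 0 η₁, ∀ ρ ∈ Set.Icc (0 : ℝ) (1 - δ),
            ∀ c ∈ Set.Icc (0 : ℝ) 1, ∀ c' ∈ Set.Icc (0 : ℝ) 1,
              P k m F η ρ c ∈ Set.Icc vlo vhi → P k m F η ρ c' ∈ Set.Icc vlo vhi →
                |Dρ k m F η (ρ, c) / Dc k m F η (ρ, c) - Dρ k m F η (ρ, c') / Dc k m F η (ρ, c')| ≤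
                  Θ * |c - c'|)
    (k : ℕ) (hk : k = 2 ∨ k = 3) (γ : unitInterval → ℝ × ℝ) (hγ : PathOK k γ)
    (m : ℕ) (F : Fin m → Quad (Set.univ : Set ℂ)) (hm : 0 < m) :
    ∀ δ : ℝ, 0 < δ → δ ≤ 1 / 2 → ∀ vlo vhi : ℝ, 0 < vlo → vlo < vhi → vhi < 1 →
      ∃ Λ η₁ : ℝ, 0 < η₁ ∧ ∀ η ∈ Set.Ioo 0 η₁,
        ∀ ρ₀ ∈ Set.Icc (0 : ℝ) (1 - δ), ∀ c₀ ∈ Set.Icc (0 : ℝ) 1,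
        ∀ ρ₁ ∈ Set.Icc (0 : ℝ) (1 - δ), ∀ c₁ ∈ Set.Icc (0 : ℝ) 1,
          P k m F η ρ₀ c₀ ∈ Set.Icc vlo vhi → P k m F η ρ₁ c₁ = P k m F η ρ₀ c₀ →
            Dc k m F η (ρ₁, c₁) ≤ Λ * Dc k m F η (ρ₀, c₀) := by
  intro δ hδ hδ' vlo vhi hvlo hvv hvhi
  -- THE BET on the wider band `[vlo/2, (1+vhi)/2]`, boundary values, positivity of `Dc`
  obtain ⟨Θ, ηB, hΘ, hηB, hB⟩ := hBET k hk γ hγ m F hm δ hδ hδ' (vlo / 2) ((1 + vhi) / 2)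
    (by positivity) (by linarith) (by linarith)
  obtain ⟨ηV, hηV, hBV⟩ := stub_boundaryValues k hk γ hγ m F hm δ hδ hδ' vlo vhi hvlo hvv hvhi
  obtain ⟨ηL, hηL, hLC⟩ :=
    levelCurves_unconditional k hk γ hγ m F hm δ hδ hδ' vlo vhi hvlo hvv hvhi
  refine ⟨Real.exp Θ, min ηB (min ηV ηL), lt_min hηB (lt_min hηV hηL), ?_⟩
  intro η hη ρ₀ hρ₀ c₀ hc₀ ρ₁ hρ₁ c₁ hc₁ hband hlev
  have hηB' : η ∈ Set.Ioo 0 ηB := ⟨hη.1, lt_of_lt_of_le hη.2 (min_le_left _ _)⟩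
  have hηV' : η ∈ Set.Ioo 0 ηV :=
    ⟨hη.1, lt_of_lt_of_le hη.2 ((min_le_right _ _).trans (min_le_left _ _))⟩
  have hηL' : η ∈ Set.Ioo 0 ηL :=
    ⟨hη.1, lt_of_lt_of_le hη.2 ((min_le_right _ _).trans (min_le_right _ _))⟩
  have hη0 : η ≠ 0 := hη.1.ne'
  obtain ⟨-, -, -, -, -, hPOS, -⟩ := hLC η hηL'
  have hBVη := hBV η hηV'
  set v := P k m F η ρ₀ c₀ with hv
  -- the polynomial `Φ` and its partials on the square
  obtain ⟨Φ, hΦ, hPΦ⟩ := exists_contDiff_two_eq_P k m F hη0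
  have hΦd : Differentiable ℝ Φ := hΦ.differentiable (by norm_num)
  have hDρ : ∀ ρ ∈ Set.Icc (0 : ℝ) 1, ∀ c ∈ Set.Icc (0 : ℝ) 1,
      Dρ k m F η (ρ, c) = fderiv ℝ Φ (ρ, c) (1, 0) := fun ρ hρ c hc =>
    derivWithin_eq_fderiv_fst (hΦd (ρ, c)) hρ (fun ρ' hρ' => hPΦ ρ' hρ' c hc)
  have hDc : ∀ ρ ∈ Set.Icc (0 : ℝ) 1, ∀ c ∈ Set.Icc (0 : ℝ) 1,
      Dc k m F η (ρ, c) = fderiv ℝ Φ (ρ, c) (0, 1) := fun ρ hρ c hc =>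
    derivWithin_eq_fderiv_snd (hΦd (ρ, c)) hc (fun c' hc' => hPΦ ρ hρ c' hc')
  have hI : ∀ ρ ∈ Set.Icc (0 : ℝ) (1 - δ), ρ ∈ Set.Icc (0 : ℝ) 1 :=
    fun ρ hρ => ⟨hρ.1, by linarith [hρ.2]⟩
  have h0 : (0 : ℝ) ∈ Set.Icc (0 : ℝ) 1 := ⟨le_rfl, zero_le_one⟩
  have h1 : (1 : ℝ) ∈ Set.Icc (0 : ℝ) 1 := ⟨zero_le_one, le_rfl⟩
  -- the level-`v` leaf over `[0, 1-δ]` (implicit function theorem)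
  have hmonoΦ : ∀ ρ ∈ Set.Icc (0 : ℝ) (1 - δ), MonotoneOn (fun c => Φ (ρ, c)) (Set.Icc 0 1) := by
    intro ρ hρ c hc c' hc' hcc'
    show Φ (ρ, c) ≤ Φ (ρ, c')
    rw [← hPΦ ρ (hI ρ hρ) c hc, ← hPΦ ρ (hI ρ hρ) c' hc']
    exact P_mono_c k m F hη0 ρ hcc'
  have hbv : ∀ ρ ∈ Set.Icc (0 : ℝ) (1 - δ), Φ (ρ, 0) < v ∧ v < Φ (ρ, 1) := by
    intro ρ hρ
    rw [← hPΦ ρ (hI ρ hρ) 0 h0, ← hPΦ ρ (hI ρ hρ) 1 h1]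
    exact ⟨lt_of_lt_of_le (hBVη ρ hρ).1 hband.1, lt_of_le_of_lt hband.2 (hBVη ρ hρ).2⟩
  have hposΦ : ∀ ρ ∈ Set.Icc (0 : ℝ) (1 - δ), ∀ c ∈ Set.Icc (0 : ℝ) 1, Φ (ρ, c) = v →
      0 < fderiv ℝ Φ (ρ, c) (0, 1) := by
    intro ρ hρ c hc hcv
    rw [← hDc ρ (hI ρ hρ) c hc]
    refine hPOS ρ hρ c hc ?_
    rw [hPΦ ρ (hI ρ hρ) c hc, hcv]
    exact hband
  obtain ⟨ℓ, hℓ, hℓ'⟩ :=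
    stub_levelCurve_IFT Φ (hΦ.of_le (by norm_num)) 0 (1 - δ) v hbv hmonoΦ hposΦ
  have hℓ01 : ∀ ρ ∈ Set.Icc (0 : ℝ) (1 - δ), ℓ ρ ∈ Set.Icc (0 : ℝ) 1 := fun ρ hρ =>
    ⟨(hℓ ρ hρ).1.1.le, (hℓ ρ hρ).1.2.le⟩
  have hc₀ℓ : c₀ = ℓ ρ₀ := (hℓ ρ₀ hρ₀).2.2 c₀ hc₀ (by rw [← hPΦ ρ₀ (hI ρ₀ hρ₀) c₀ hc₀])
  have hc₁ℓ : c₁ = ℓ ρ₁ :=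
    (hℓ ρ₁ hρ₁).2.2 c₁ hc₁ (by rw [← hPΦ ρ₁ (hI ρ₁ hρ₁) c₁ hc₁]; exact hlev)
  have hposℓ : ∀ ρ ∈ Set.Icc (0 : ℝ) (1 - δ), 0 < fderiv ℝ Φ (ρ, ℓ ρ) (0, 1) := fun ρ hρ =>
    hposΦ ρ hρ (ℓ ρ) (hℓ01 ρ hρ) (hℓ ρ hρ).2.1
  -- THE BET bounds the `c`-derivative of the slope at the leaf points
  have hR : ∀ ρ ∈ Set.Icc (0 : ℝ) (1 - δ), ∀ R' : ℝ,
      HasDerivAt (fun y => fderiv ℝ Φ (ρ, y) (1, 0) / fderiv ℝ Φ (ρ, y) (0, 1)) R' (ℓ ρ) →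
        |R'| ≤ Θ := by
    intro ρ hρ R' hR'
    have hρ1 := hI ρ hρ
    obtain ⟨hℓI, hℓv, -⟩ := hℓ ρ hρ
    have hcont : ContinuousAt (fun y => Φ (ρ, y)) (ℓ ρ) :=
      (hΦ.continuous.comp (continuous_const.prodMk continuous_id)).continuousAt
    have ev1 : ∀ᶠ y in 𝓝 (ℓ ρ), y ∈ Set.Ioo (0 : ℝ) 1 := isOpen_Ioo.mem_nhds hℓI
    have ev2 : ∀ᶠ y in 𝓝 (ℓ ρ), Φ (ρ, y) ∈ Set.Ioo (vlo / 2) ((1 + vhi) / 2) := by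
      refine hcont.preimage_mem_nhds ?_
      show Set.Ioo (vlo / 2) ((1 + vhi) / 2) ∈ 𝓝 (Φ (ρ, ℓ ρ))
      rw [hℓv]
      exact isOpen_Ioo.mem_nhds ⟨by linarith [hband.1], by linarith [hband.2]⟩
    have h := hR'.le_of_lip' hΘ ?_
    · simpa only [Real.norm_eq_abs] using h
    filter_upwards [ev1, ev2] with y hy1 hy2
    have hy01 : y ∈ Set.Icc (0 : ℝ) 1 := ⟨hy1.1.le, hy1.2.le⟩
    have hPy : P k m F η ρ y ∈ Set.Icc (vlo / 2) ((1 + vhi) / 2) := by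
      rw [hPΦ ρ hρ1 y hy01]
      exact ⟨hy2.1.le, hy2.2.le⟩
    have hPℓ : P k m F η ρ (ℓ ρ) ∈ Set.Icc (vlo / 2) ((1 + vhi) / 2) := by
      rw [hPΦ ρ hρ1 _ (hℓ01 ρ hρ), hℓv]
      exact ⟨by linarith [hband.1], by linarith [hband.2]⟩
    have hb := hB η hηB' ρ hρ y hy01 (ℓ ρ) (hℓ01 ρ hρ) hPy hPℓ
    rw [hDρ ρ hρ1 y hy01, hDc ρ hρ1 y hy01, hDρ ρ hρ1 _ (hℓ01 ρ hρ), hDc ρ hρ1 _ (hℓ01 ρ hρ)]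
      at hb
    simpa only [Real.norm_eq_abs] using hb
  -- transport along the leaf
  have hT := bulk_leaf_transport hΦ hℓ' hposℓ hR ρ₁ hρ₁ ρ₀ hρ₀
  rw [hDc ρ₁ (hI ρ₁ hρ₁) c₁ hc₁, hDc ρ₀ (hI ρ₀ hρ₀) c₀ hc₀, hc₀ℓ, hc₁ℓ]
  refine hT.trans (mul_le_mul_of_nonneg_right (Real.exp_le_exp.2 ?_) (hposℓ ρ₀ hρ₀).le)
  have habs : |ρ₁ - ρ₀| ≤ 1 :=
    abs_sub_le_iff.2 ⟨by linarith [hρ₁.2, hρ₀.1], by linarith [hρ₀.2, hρ₁.1]⟩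
  exact mul_le_of_le_one_right hΘ habs

/-- **Corner clause of `stub_levelSetTransport`.**  The corner BET and the corner patch imply: for
`δ := δ_B / 2` (half the corner BET's depth), same-level band points of `[1-2δ, 1] × [0,1]` have
comparable `|Dρ|`, mesh-uniformly. -/
theorem levelSetTransport_corner
    (hCB : ∀ k : ℕ, k = 2 ∨ k = 3 → ∀ γ : unitInterval → ℝ × ℝ, PathOK k γ →
      ∀ (m : ℕ) (F : Fin m → Quad (Set.univ : Set ℂ)), 0 < m →
        ∃ δ : ℝ, 0 < δ ∧ δ ≤ 1 / 4 ∧ ∀ vlo vhi : ℝ, 0 < vlo → vlo < vhi → vhi < 1 →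
          ∃ Θ η₁ : ℝ, 0 ≤ Θ ∧ 0 < η₁ ∧ ∀ η ∈ Set.Ioo 0 η₁, ∀ c ∈ Set.Icc (0 : ℝ) 1,
            ∀ ρ ∈ Set.Icc (1 - 2 * δ) 1, ∀ ρ' ∈ Set.Icc (1 - 2 * δ) 1,
              P k m F η ρ c ∈ Set.Icc vlo vhi → P k m F η ρ' c ∈ Set.Icc vlo vhi →
                Dρ k m F η (ρ, c) ≠ 0 ∧
                |Dc k m F η (ρ, c) / Dρ k m F η (ρ, c) - Dc k m F η (ρ', c) / Dρ k m F η (ρ', c)| ≤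
                  Θ * |ρ - ρ'|)
    (hCP : ∀ k : ℕ, k = 2 ∨ k = 3 → ∀ (m : ℕ) (F : Fin m → Quad (Set.univ : Set ℂ)), 0 < m →
      ∀ vlo vhi : ℝ, 0 < vlo → vlo < vhi → vhi < 1 →
        ∃ Λ η₁ : ℝ, 0 < η₁ ∧ ∀ η ∈ Set.Ioo 0 η₁,
          ∀ q ∈ Set.Icc (0 : ℝ) 1 ×ˢ Set.Icc (0 : ℝ) 1,
            ∀ q' ∈ Set.Icc (0 : ℝ) 1 ×ˢ Set.Icc (0 : ℝ) 1,
            (q.1 = 1 ∨ q.2 = 0) → (q'.1 = 1 ∨ q'.2 = 0) →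
              P k m F η q.1 q.2 ∈ Set.Icc vlo vhi → P k m F η q'.1 q'.2 ∈ Set.Icc vlo vhi →
                |Dρ k m F η q| ≤ Λ * |Dρ k m F η q'|)
    (k : ℕ) (hk : k = 2 ∨ k = 3) (γ : unitInterval → ℝ × ℝ) (hγ : PathOK k γ)
    (m : ℕ) (F : Fin m → Quad (Set.univ : Set ℂ)) (hm : 0 < m) :
    ∃ δ : ℝ, 0 < δ ∧ δ ≤ 1 / 4 ∧ ∀ vlo vhi : ℝ, 0 < vlo → vlo < vhi → vhi < 1 →
      ∃ Λ η₁ : ℝ, 0 < η₁ ∧ ∀ η ∈ Set.Ioo 0 η₁,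
        ∀ ρ₀ ∈ Set.Icc (1 - 2 * δ) 1, ∀ c₀ ∈ Set.Icc (0 : ℝ) 1,
        ∀ ρ₁ ∈ Set.Icc (1 - 2 * δ) 1, ∀ c₁ ∈ Set.Icc (0 : ℝ) 1,
          P k m F η ρ₀ c₀ ∈ Set.Icc vlo vhi → P k m F η ρ₁ c₁ = P k m F η ρ₀ c₀ →
            |Dρ k m F η (ρ₁, c₁)| ≤ Λ * |Dρ k m F η (ρ₀, c₀)| := by
  obtain ⟨δB, hδB, hδB4, hCB'⟩ := hCB k hk γ hγ m F hm
  refine ⟨δB / 2, by positivity, by linarith, fun vlo vhi hvlo hvv hvhi => ?_⟩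
  -- the corner BET on the wider band `[vlo/2, (1+vhi)/2]`, the patch on `[vlo, vhi]`, `P(ρ,1) = 1`
  obtain ⟨Θ, ηT, hΘ, hηT, hT⟩ :=
    hCB' (vlo / 2) ((1 + vhi) / 2) (by positivity) (by linarith) (by linarith)
  obtain ⟨ΛP, ηP, hηP, hPt⟩ := hCP k hk m F hm vlo vhi hvlo hvv hvhi
  obtain ⟨η₇, hη₇, hP1⟩ := P_one_eq_one_of_mem_Ioo hk m F
  refine ⟨Real.exp Θ * max ΛP 0 * Real.exp Θ, min ηT (min ηP η₇), lt_min hηT (lt_min hηP hη₇), ?_⟩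
  intro η hη ρ₀ hρ₀ c₀ hc₀ ρ₁ hρ₁ c₁ hc₁ hband hlev
  have hηT' : η ∈ Set.Ioo 0 ηT := ⟨hη.1, lt_of_lt_of_le hη.2 (min_le_left _ _)⟩
  have hηP' : η ∈ Set.Ioo 0 ηP :=
    ⟨hη.1, lt_of_lt_of_le hη.2 ((min_le_right _ _).trans (min_le_left _ _))⟩
  have hη7' : η ∈ Set.Ioo 0 η₇ :=
    ⟨hη.1, lt_of_lt_of_le hη.2 ((min_le_right _ _).trans (min_le_right _ _))⟩
  have hη0 : η ≠ 0 := hη.1.ne'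
  have h2δ : 1 - 2 * (δB / 2) = 1 - δB := by ring
  rw [h2δ] at hρ₀ hρ₁
  set v := P k m F η ρ₀ c₀ with hv
  -- the polynomial `Φ` and its partials on the square
  obtain ⟨Φ, hΦ, hPΦ⟩ := exists_contDiff_two_eq_P k m F hη0
  have hΦd : Differentiable ℝ Φ := hΦ.differentiable (by norm_num)
  have hDρ : ∀ ρ ∈ Set.Icc (0 : ℝ) 1, ∀ c ∈ Set.Icc (0 : ℝ) 1,
      Dρ k m F η (ρ, c) = fderiv ℝ Φ (ρ, c) (1, 0) := fun ρ hρ c hc =>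
    derivWithin_eq_fderiv_fst (hΦd (ρ, c)) hρ (fun ρ' hρ' => hPΦ ρ' hρ' c hc)
  have hDc : ∀ ρ ∈ Set.Icc (0 : ℝ) 1, ∀ c ∈ Set.Icc (0 : ℝ) 1,
      Dc k m F η (ρ, c) = fderiv ℝ Φ (ρ, c) (0, 1) := fun ρ hρ c hc =>
    derivWithin_eq_fderiv_snd (hΦd (ρ, c)) hc (fun c' hc' => hPΦ ρ hρ c' hc')
  have hstrip : ∀ ρ ∈ Set.Icc (1 - δB) 1, ρ ∈ Set.Icc (0 : ℝ) 1 ∧ ρ ∈ Set.Icc (1 - 2 * δB) 1 :=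
    fun ρ hρ => ⟨⟨by linarith [hρ.1], hρ.2⟩, ⟨by linarith [hρ.1], hρ.2⟩⟩
  have hwide : Set.Icc vlo vhi ⊆ Set.Icc (vlo / 2) ((1 + vhi) / 2) :=
    Set.Icc_subset_Icc (by linarith) (by linarith)
  -- `Φ_c = Dc ≥ 0` on the square (`P` is monotone in `c`)
  have hcnn : ∀ q : ℝ × ℝ, q.1 ∈ Set.Icc (0 : ℝ) 1 → q.2 ∈ Set.Icc (0 : ℝ) 1 →
      0 ≤ fderiv ℝ Φ q (0, 1) := by
    rintro ⟨ρ, c⟩ hρ hc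
    rw [← hDc ρ hρ c hc]
    have hmono : Monotone fun c' => P k m F η ρ c' := fun a b h => P_mono_c k m F hη0 ρ h
    exact (hmono.monotoneOn _).derivWithin_nonneg
  -- the corner BET bounds `∂_ρ(Φ_c/Φ_ρ)` at the level-`v` points of the strip `[1-δB, 1] × [0,1]`
  have hS : ∀ q : ℝ × ℝ, q.1 ∈ Set.Icc (1 - δB) 1 → q.2 ∈ Set.Icc (0 : ℝ) 1 → Φ q = v →
      ∀ S' : ℝ, HasDerivAt (fun r => fderiv ℝ Φ (r, q.2) (0, 1) / fderiv ℝ Φ (r, q.2) (1, 0))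
        S' q.1 → |S'| ≤ Θ := by
    rintro ⟨ρ, c⟩ hρ hc hqv S' hS'
    dsimp only at hρ hc hqv hS' ⊢
    obtain ⟨hρ01, hρs⟩ := hstrip ρ hρ
    have hcont : ContinuousAt (fun r => Φ (r, c)) ρ :=
      (hΦ.continuous.comp (continuous_id.prodMk continuous_const)).continuousAt
    have ev : ∀ᶠ r in 𝓝 ρ, Φ (r, c) ∈ Set.Ioo (vlo / 2) ((1 + vhi) / 2) := by
      refine hcont.preimage_mem_nhds ?_
      show Set.Ioo (vlo / 2) ((1 + vhi) / 2) ∈ 𝓝 (Φ (ρ, c))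
      rw [hqv]
      exact isOpen_Ioo.mem_nhds ⟨by linarith [hband.1], by linarith [hband.2]⟩
    obtain ⟨ε, hε, hballε⟩ := Metric.eventually_nhds_iff.1 ev
    refine abs_le_of_hasDerivAt_of_left_lip hS' (lt_min hε hδB) (fun z hz => ?_)
    have hz1 : dist z ρ < ε := by
      rw [Real.dist_eq, abs_of_neg (by linarith [hz.2])]
      linarith [hz.1, min_le_left ε δB]
    have hzs : z ∈ Set.Icc (1 - 2 * δB) 1 :=
      ⟨by linarith [hz.1, min_le_right ε δB, hρ.1], by linarith [hz.2, hρ.2]⟩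
    have hz01 : z ∈ Set.Icc (0 : ℝ) 1 := ⟨by linarith [hzs.1], hzs.2⟩
    have hPz : P k m F η z c ∈ Set.Icc (vlo / 2) ((1 + vhi) / 2) := by
      rw [hPΦ z hz01 c hc]
      exact ⟨(hballε hz1).1.le, (hballε hz1).2.le⟩
    have hPρ : P k m F η ρ c ∈ Set.Icc (vlo / 2) ((1 + vhi) / 2) := by
      rw [hPΦ ρ hρ01 c hc, hqv]
      exact hwide hband
    obtain ⟨-, hb⟩ := hT η hηT' c hc ρ hρs z hzs hPρ hPz
    rw [hDρ ρ hρ01 c hc, hDc ρ hρ01 c hc, hDρ z hz01 c hc, hDc z hz01 c hc] at hb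
    rw [abs_sub_comm, abs_sub_comm z ρ]
    exact hb
  -- no level-`v` point on the top edge `c = 1` (`P(ρ,1) = 1 > vhi`)
  have htop : ∀ ρ ∈ Set.Icc (1 - δB) 1, Φ (ρ, 1) ≠ v := by
    intro ρ hρ h
    have h1 := hP1 η hη7' ρ
    rw [hPΦ ρ (hstrip ρ hρ).1 1 ⟨zero_le_one, le_rfl⟩, h] at h1
    linarith [hband.2]
  -- `Φ_ρ ≠ 0` at the level-`v` points of the strip (corner BET with `ρ = ρ'`)
  have hne : ∀ ρ ∈ Set.Icc (1 - δB) 1, ∀ c ∈ Set.Icc (0 : ℝ) 1, P k m F η ρ c = v →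
      fderiv ℝ Φ (ρ, c) (1, 0) ≠ 0 := by
    intro ρ hρ c hc hPv
    obtain ⟨hρ01, hρs⟩ := hstrip ρ hρ
    have hPb : P k m F η ρ c ∈ Set.Icc (vlo / 2) ((1 + vhi) / 2) := by
      rw [hPv]
      exact hwide hband
    have h := (hT η hηT' c hc ρ hρs ρ hρs hPb hPb).1
    rwa [hDρ ρ hρ01 c hc] at h
  -- the two endpoints on the slices `{ρ = 1} ∪ {c = 0}`
  have hρlo : 0 < 1 - δB := by linarith
  obtain ⟨⟨e₀ρ, e₀c⟩, he₀ρ, he₀c, he₀s, he₀v, he₀1, he₀2⟩ := corner_endpoint hΦ hρlo hΘ hcnn hS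
    htop (q₀ := (ρ₀, c₀)) hρ₀ hc₀ (by rw [← hPΦ ρ₀ (hstrip ρ₀ hρ₀).1 c₀ hc₀])
    (hne ρ₀ hρ₀ c₀ hc₀ rfl)
  obtain ⟨⟨e₁ρ, e₁c⟩, he₁ρ, he₁c, he₁s, he₁v, he₁1, he₁2⟩ := corner_endpoint hΦ hρlo hΘ hcnn hS
    htop (q₀ := (ρ₁, c₁)) hρ₁ hc₁ (by rw [← hPΦ ρ₁ (hstrip ρ₁ hρ₁).1 c₁ hc₁]; exact hlev)
    (hne ρ₁ hρ₁ c₁ hc₁ hlev)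
  dsimp only at he₀ρ he₀c he₀s he₀v he₀1 he₀2 he₁ρ he₁c he₁s he₁v he₁1 he₁2
  -- the patch compares the endpoints
  have hPe₀ : P k m F η e₀ρ e₀c ∈ Set.Icc vlo vhi := by
    rw [hPΦ e₀ρ (hstrip e₀ρ he₀ρ).1 e₀c he₀c, he₀v]
    exact hband
  have hPe₁ : P k m F η e₁ρ e₁c ∈ Set.Icc vlo vhi := by
    rw [hPΦ e₁ρ (hstrip e₁ρ he₁ρ).1 e₁c he₁c, he₁v]
    exact hband
  have hpatch := hPt η hηP' (e₁ρ, e₁c) ⟨(hstrip e₁ρ he₁ρ).1, he₁c⟩ (e₀ρ, e₀c)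
    ⟨(hstrip e₀ρ he₀ρ).1, he₀c⟩ he₁s he₀s hPe₁ hPe₀
  rw [hDρ e₁ρ (hstrip e₁ρ he₁ρ).1 e₁c he₁c, hDρ e₀ρ (hstrip e₀ρ he₀ρ).1 e₀c he₀c] at hpatch
  rw [hDρ ρ₁ (hstrip ρ₁ hρ₁).1 c₁ hc₁, hDρ ρ₀ (hstrip ρ₀ hρ₀).1 c₀ hc₀]
  calc |fderiv ℝ Φ (ρ₁, c₁) (1, 0)| ≤ Real.exp Θ * |fderiv ℝ Φ (e₁ρ, e₁c) (1, 0)| := he₁1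
    _ ≤ Real.exp Θ * (max ΛP 0 * |fderiv ℝ Φ (e₀ρ, e₀c) (1, 0)|) := by
        gcongr
        exact hpatch.trans (mul_le_mul_of_nonneg_right (le_max_left _ _) (abs_nonneg _))
    _ ≤ Real.exp Θ * (max ΛP 0 * (Real.exp Θ * |fderiv ℝ Φ (ρ₀, c₀) (1, 0)|)) := by
        gcongr
    _ = Real.exp Θ * max ΛP 0 * Real.exp Θ * |fderiv ℝ Φ (ρ₀, c₀) (1, 0)| := by ring

/-- **STUB `stub_levelSetTransport`** of line `monotone-product-coordinates` (crux
`GradientComparability`): THE BET, the corner BET and the corner patch imply the LEVEL-SET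
COMPARABILITY of the Russo gradient — two band points of `[0,1-δ] × [0,1]` on the same level have
comparable `Dc` (bulk: `levelSetTransport_bulk`), and for the depth `δ := δ_B/2` two band points of
`[1-2δ,1] × [0,1]` on the same level have comparable `|Dρ|` (corner: `levelSetTransport_corner`),
mesh-uniformly. -/
theorem stub_levelSetTransport :
    (∀ k : ℕ, k = 2 ∨ k = 3 → ∀ γ : unitInterval → ℝ × ℝ, PathOK k γ →
      ∀ (m : ℕ) (F : Fin m → Quad (Set.univ : Set ℂ)), 0 < m → ∀ δ : ℝ, 0 < δ → δ ≤ 1 / 2 →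
        ∀ vlo vhi : ℝ, 0 < vlo → vlo < vhi → vhi < 1 →
          ∃ Θ η₁ : ℝ, 0 ≤ Θ ∧ 0 < η₁ ∧ ∀ η ∈ Set.Ioo 0 η₁, ∀ ρ ∈ Set.Icc (0 : ℝ) (1 - δ),
            ∀ c ∈ Set.Icc (0 : ℝ) 1, ∀ c' ∈ Set.Icc (0 : ℝ) 1,
              P k m F η ρ c ∈ Set.Icc vlo vhi → P k m F η ρ c' ∈ Set.Icc vlo vhi →
                |Dρ k m F η (ρ, c) / Dc k m F η (ρ, c) - Dρ k m F η (ρ, c') / Dc k m F η (ρ, c')| ≤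
                  Θ * |c - c'|) →
    (∀ k : ℕ, k = 2 ∨ k = 3 → ∀ γ : unitInterval → ℝ × ℝ, PathOK k γ →
      ∀ (m : ℕ) (F : Fin m → Quad (Set.univ : Set ℂ)), 0 < m →
        ∃ δ : ℝ, 0 < δ ∧ δ ≤ 1 / 4 ∧ ∀ vlo vhi : ℝ, 0 < vlo → vlo < vhi → vhi < 1 →
          ∃ Θ η₁ : ℝ, 0 ≤ Θ ∧ 0 < η₁ ∧ ∀ η ∈ Set.Ioo 0 η₁, ∀ c ∈ Set.Icc (0 : ℝ) 1,
            ∀ ρ ∈ Set.Icc (1 - 2 * δ) 1, ∀ ρ' ∈ Set.Icc (1 - 2 * δ) 1,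
              P k m F η ρ c ∈ Set.Icc vlo vhi → P k m F η ρ' c ∈ Set.Icc vlo vhi →
                Dρ k m F η (ρ, c) ≠ 0 ∧
                |Dc k m F η (ρ, c) / Dρ k m F η (ρ, c) - Dc k m F η (ρ', c) / Dρ k m F η (ρ', c)| ≤
                  Θ * |ρ - ρ'|) →
    (∀ k : ℕ, k = 2 ∨ k = 3 → ∀ (m : ℕ) (F : Fin m → Quad (Set.univ : Set ℂ)), 0 < m →
      ∀ vlo vhi : ℝ, 0 < vlo → vlo < vhi → vhi < 1 →
        ∃ Λ η₁ : ℝ, 0 < η₁ ∧ ∀ η ∈ Set.Ioo 0 η₁,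
          ∀ q ∈ Set.Icc (0 : ℝ) 1 ×ˢ Set.Icc (0 : ℝ) 1,
            ∀ q' ∈ Set.Icc (0 : ℝ) 1 ×ˢ Set.Icc (0 : ℝ) 1,
            (q.1 = 1 ∨ q.2 = 0) → (q'.1 = 1 ∨ q'.2 = 0) →
              P k m F η q.1 q.2 ∈ Set.Icc vlo vhi → P k m F η q'.1 q'.2 ∈ Set.Icc vlo vhi →
                |Dρ k m F η q| ≤ Λ * |Dρ k m F η q'|) →
    ∀ k : ℕ, k = 2 ∨ k = 3 → ∀ γ : unitInterval → ℝ × ℝ, PathOK k γ →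
      ∀ (m : ℕ) (F : Fin m → Quad (Set.univ : Set ℂ)), 0 < m →
        (∀ δ : ℝ, 0 < δ → δ ≤ 1 / 2 → ∀ vlo vhi : ℝ, 0 < vlo → vlo < vhi → vhi < 1 →
          ∃ Λ η₁ : ℝ, 0 < η₁ ∧ ∀ η ∈ Set.Ioo 0 η₁,
            ∀ ρ₀ ∈ Set.Icc (0 : ℝ) (1 - δ), ∀ c₀ ∈ Set.Icc (0 : ℝ) 1,
            ∀ ρ₁ ∈ Set.Icc (0 : ℝ) (1 - δ), ∀ c₁ ∈ Set.Icc (0 : ℝ) 1,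
              P k m F η ρ₀ c₀ ∈ Set.Icc vlo vhi → P k m F η ρ₁ c₁ = P k m F η ρ₀ c₀ →
                Dc k m F η (ρ₁, c₁) ≤ Λ * Dc k m F η (ρ₀, c₀)) ∧
        (∃ δ : ℝ, 0 < δ ∧ δ ≤ 1 / 4 ∧ ∀ vlo vhi : ℝ, 0 < vlo → vlo < vhi → vhi < 1 →
          ∃ Λ η₁ : ℝ, 0 < η₁ ∧ ∀ η ∈ Set.Ioo 0 η₁,
            ∀ ρ₀ ∈ Set.Icc (1 - 2 * δ) 1, ∀ c₀ ∈ Set.Icc (0 : ℝ) 1,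
            ∀ ρ₁ ∈ Set.Icc (1 - 2 * δ) 1, ∀ c₁ ∈ Set.Icc (0 : ℝ) 1,
              P k m F η ρ₀ c₀ ∈ Set.Icc vlo vhi → P k m F η ρ₁ c₁ = P k m F η ρ₀ c₀ →
                |Dρ k m F η (ρ₁, c₁)| ≤ Λ * |Dρ k m F η (ρ₀, c₀)|) := by
  intro hBET hCB hCP k hk γ hγ m F hm
  exact ⟨levelSetTransport_bulk hBET k hk γ hγ m F hm,
    levelSetTransport_corner hCB hCP k hk γ hγ m F hm⟩

end Summit.CriticalPhenomena.CardyFormulaZ2.Theorems.CardySelfRefinement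

end
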